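import Literature.NumberTheory.Automorphic.UnitaryThreeFixedPointsCountTheta            -- ★ (F3c-C9-θ) B-p04 + B-p12's (F3c-γ) + ★ p840967
import Literature.NumberTheory.Automorphic.UnitaryThreePHTowerPackage                   -- ★ (F3c-β-ii) FILE D: `finite_quotient_flickerHK`, the index
import Literature.NumberTheory.Automorphic.UnitaryThreeBorelCosetCount                  -- ★ A-p03: `borel_conj_mem_flickerHK_iff`, `exists_coe_eq_borel_of_mem_flickerPH`
import HarnessLib

/-!
# The fixed-point set of a θ-torus element on `H ⧸ H^K_m` is FINITE — the hypothesis `hfin` of Flicker's Cor. 9 DISCHARGED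
(Flicker, *Elementary proof of the fundamental lemma for a unitary group* (1998), Cor. 9 p. 85 with Prop. 6 p. 83, Prop. 8 p. 84, Prop. 10 p. 85)

Topic `NumberTheory/Automorphic`; namespace `Literature.NumberTheory.Automorphic.UnitaryGroup`.  THEOREMS ONLY (no `def`, no instance, no notation, no named fact,
no `sorry`; `synthInstance.maxHeartbeats` bumps for the `MulAction` instance on `↥H ⧸ M`).  Cell `pub/hodgecm-mathlib`, F0∕P3a road «N7-ns COUNT FROM FLICKER»
(MAP v3, architect A-p06 (g26)), brick **(F3c-C9-fin)** (B-p04 (g33), 06:08Z): the last structural hypothesis of ★ (F3c-C9-θ) `natCard_fixedPoints_flickerTorus_eq_finsum`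
(p841650) removed.  PROOF: ★ `exists_equiv_sigma_prod_fixedPoints` (p840967: `Fix ≃ Σᵢ (T⧸Tᵢ) × Fᵢ`, with ★ B-p12's `hA`∕`hB` and ★ p841018's Prop. 8 (i)); (i) `T⧸Tᵢ`
finite since its index is ★ B-p12's weight `≠ 0`; (ii) `Fᵢ ⊆ P_H ⧸ (P_H ∩ H^K_m)` finite by ★ FILE D `finite_quotient_flickerHK` (transported inside `H` by
`Subgroup.relIndex_subgroupOf`); (iii) `Fᵢ = ∅` once `|C·ϖ^{−2i}| > 1` (A-p03's «`|B₂| > 1` kills every coset» argument, ★ `borel_conj_mem_flickerHK_iff`, at the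
conjugate `rᵢ⁻¹ t rᵢ = !![A,0,Bϖ^{2i}; 0,b₀,0; Cϖ^{−2i},0,A]`); so `Fix` is the image of a finite sigma type over `i ≤ i₀`.  HC_CM is proved only modulo the printed
citations until rung 0 closes; structure theory for ONE clause of #103-ns, pays nothing by itself.

* `coe_diagRadial_inv_mul_mul` — the literal of `rᵢ⁻¹ t rᵢ` for `rᵢ = diag(ϖ^{−i},1,ϖ^{i})`.
* `not_mem_flickerHK_of_one_lt` — `|B₂| > 1 ⇒ p⁻¹ τ p ∉ H^K_m` for every `p ∈ P_H` (A-p03's ★ `natCard_cosets_eq_zero_of_one_lt`, as a non-membership).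
* `exists_forall_one_lt_v_mul_inv_pow` — `|C ϖ^{−2i}| > 1` for `i` large (`C ≠ 0`).
* **`finite_fixedPoints_flickerTorus … : {x | ⟨t,htH⟩ • x = x}.Finite`** (binders: ★ p841650's + FILE D's `hσO [IsDiscreteValuationRing 𝒪[K]] [Finite 𝓀] hq ha₀`).
* **`natCard_fixedPoints_flickerTorus_eq_finsum'`** — Cor. 9 at the θ-torus with NO `hfin`.

## References
* [Flicker1998UnitaryFL] Y. Z. Flicker, *Elementary proof of the fundamental lemma for a unitary group*, Canad. J. Math. 50 (1998), Prop. 6 p. 83, Prop. 8 p. 84, Prop. 10 ∕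
  Cor. 9 p. 85.
-/

open scoped MatrixGroups WithZero Valued
open Matrix

namespace Literature.NumberTheory.Automorphic

namespace UnitaryGroup

open Literature.NumberTheory.Automorphic.HermitianLattice (unitaryInt mem_unitaryInt_iff LocalConjDatum)
open Literature.NumberTheory.Automorphic.DoubleCosetFixedPoints IsLocalRing

universe u

section Finite

variable {K : Type*} [Field K] [Valued K ℤᵐ⁰] {ϖ : K} (σ : K →+* K) {J : Matrix (Fin 3) (Fin 3) K}

/-- The conjugate `rᵢ⁻¹ t rᵢ` of a block `t = !![A,0,B;0,b₀,0;C,0,A]` by the radial `rᵢ = diag(ϖ^{−i},1,ϖ^{i})`: `!![A, 0, Bϖ^{2i}; 0, b₀, 0; Cϖ^{−2i}, 0, A]`.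
[cite: Flicker1998UnitaryFL, Prop. 10 p. 85] -/
theorem coe_diagRadial_inv_mul_mul (hd : LocalConjDatum σ ϖ) {c t : ↥(unitaryGroupOfForm σ J)}
    (htH : t ∈ Subgroup.centralizer ({c} : Set ↥(unitaryGroupOfForm σ J))) {A B C b₀ : K}
    (hte : ((t : GL (Fin 3) K) : Matrix (Fin 3) (Fin 3) K) = !![A, 0, B; 0, b₀, 0; C, 0, A])
    (r : ℕ → ↥(Subgroup.centralizer ({c} : Set ↥(unitaryGroupOfForm σ J))))
    (hr : ∀ i, (((r i : ↥(unitaryGroupOfForm σ J)) : GL (Fin 3) K) : Matrix (Fin 3) (Fin 3) K) = !![(ϖ ^ i)⁻¹, 0, 0; 0, 1, 0; 0, 0, ϖ ^ i])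
    (i : ℕ) :
    ((((r i)⁻¹ * ⟨t, htH⟩ * r i : ↥(Subgroup.centralizer ({c} : Set ↥(unitaryGroupOfForm σ J)))) : ↥(unitaryGroupOfForm σ J)) : GL (Fin 3) K) =
      (!![A, 0, B * ϖ ^ (2 * i); 0, b₀, 0; C * (ϖ ^ (2 * i))⁻¹, 0, A] : Matrix (Fin 3) (Fin 3) K) := by
  have hϖ0 : ϖ ≠ 0 := fun h0 => by have := hd.vϖ; rw [h0, map_zero] at this; exact WithZero.zero_ne_coe this
  have hti : ϖ ^ i ≠ 0 := pow_ne_zero _ hϖ0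
  -- `rᵢ · X = t · rᵢ` with `X` the claimed matrix, then cancel `rᵢ`
  have hRX : (((r i : ↥(unitaryGroupOfForm σ J)) : GL (Fin 3) K) : Matrix (Fin 3) (Fin 3) K) *
      !![A, 0, B * ϖ ^ (2 * i); 0, b₀, 0; C * (ϖ ^ (2 * i))⁻¹, 0, A] =
      ((t : GL (Fin 3) K) : Matrix (Fin 3) (Fin 3) K) * (((r i : ↥(unitaryGroupOfForm σ J)) : GL (Fin 3) K) : Matrix (Fin 3) (Fin 3) K) := by
    rw [hr, hte]
    ext a b
    fin_cases a <;> fin_cases b <;> simp [Matrix.mul_apply, Fin.sum_univ_three, pow_mul, pow_two] <;> field_simp <;> ring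
  have hinv : ((((r i : ↥(unitaryGroupOfForm σ J)) : GL (Fin 3) K)⁻¹ : GL (Fin 3) K) : Matrix (Fin 3) (Fin 3) K) *
      (((r i : ↥(unitaryGroupOfForm σ J)) : GL (Fin 3) K) : Matrix (Fin 3) (Fin 3) K) = 1 := by
    rw [← Units.val_mul, inv_mul_cancel, Units.val_one]
  have e : ((((r i)⁻¹ * ⟨t, htH⟩ * r i : ↥(Subgroup.centralizer ({c} : Set ↥(unitaryGroupOfForm σ J)))) : ↥(unitaryGroupOfForm σ J)) : GL (Fin 3) K) =
      ((r i : ↥(unitaryGroupOfForm σ J)) : GL (Fin 3) K)⁻¹ * ((t : GL (Fin 3) K) * ((r i : ↥(unitaryGroupOfForm σ J)) : GL (Fin 3) K)) := by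
    simp only [Subgroup.coe_mul, InvMemClass.coe_inv, mul_assoc]
  rw [e, Units.val_mul, Units.val_mul, ← hRX, ← Matrix.mul_assoc, hinv, Matrix.one_mul]

/-- For `i` large (`|C·ϖ^{−2i}| > 1`) NO element of `P_H` conjugates `rᵢ⁻¹ t rᵢ` into `H^K_m` (the `(2,0)` entry `uσu·Cϖ^{−2i}` of `p⁻¹(rᵢ⁻¹trᵢ)p` is not integral).
[cite: Flicker1998UnitaryFL, Prop. 10 p. 85] -/
theorem not_mem_flickerHK_of_one_lt (hJ : J = (StdForm.antidiagonal 3).over K) (hd : LocalConjDatum σ ϖ) {y : K} (hy : y * σ y = -2) (m : ℕ)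
    {c um τ : ↥(unitaryGroupOfForm σ J)} (hc : ((c : GL (Fin 3) K) : Matrix (Fin 3) (Fin 3) K) = !![1, 0, 0; 0, -1, 0; 0, 0, 1])
    (hum : ((um : GL (Fin 3) K) : Matrix (Fin 3) (Fin 3) K) = !![ϖ ^ m, y, (ϖ ^ m)⁻¹; 0, 1, -σ y * (ϖ ^ m)⁻¹; 0, 0, (ϖ ^ m)⁻¹])
    {A B₁ B₂ b : K} (hτ : ((τ : GL (Fin 3) K) : Matrix (Fin 3) (Fin 3) K) = !![A, 0, B₁; 0, b, 0; B₂, 0, A])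
    (hτH : τ ∈ Subgroup.centralizer ({c} : Set ↥(unitaryGroupOfForm σ J))) (hgt : 1 < Valued.v B₂)
    {p : ↥(unitaryGroupOfForm σ J)} (hp : p ∈ flickerPH σ J c) : p⁻¹ * τ * p ∉ flickerHK σ J c um := by
  intro hmem
  have h2 : (2 : K) ≠ 0 := fun h => by have := hd.v2; rw [h, map_zero] at this; exact zero_ne_one this
  obtain ⟨u, x, w, hpm, hvu, -, -, hvw, -⟩ := exists_coe_eq_borel_of_mem_flickerPH σ hJ hd hc hp
  have hu0 : u ≠ 0 := fun h => by rw [h, map_zero] at hvu; exact zero_ne_one hvu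
  have hσu0 : σ u ≠ 0 := fun h => hu0 (by rw [← hd.σσ u, h, map_zero])
  have hw0 : w ≠ 0 := fun h => by rw [h, map_zero] at hvw; exact zero_ne_one hvw
  have hpH : p ∈ Subgroup.centralizer ({c} : Set ↥(unitaryGroupOfForm σ J)) := ((mem_flickerPH_iff h2 hc).1 hp).1.1
  obtain ⟨h₁, -, -, -⟩ := (borel_conj_mem_flickerHK_iff σ hJ hd hy m hu0 hσu0 hw0 hum hpm hτ hpH hτH).1 hmem
  rw [map_mul, map_mul, hd.vσ, hvu, one_mul, one_mul] at h₁
  exact absurd hgt (not_lt.2 h₁)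

/-- In `ℤᵐ⁰`: for `C ≠ 0` and `|ϖ| = exp(−1)`, `|C·(ϖ^{2i})⁻¹| > 1` for all large `i`. [cite: Flicker1998UnitaryFL, Prop. 10 p. 85] -/
theorem exists_forall_one_lt_v_mul_inv_pow (hϖ : Valued.v ϖ = WithZero.exp (-1 : ℤ)) {C : K} (hC : C ≠ 0) :
    ∃ i₀ : ℕ, ∀ i, i₀ < i → 1 < Valued.v (C * (ϖ ^ (2 * i))⁻¹) := by
  have hC0 : Valued.v C ≠ 0 := (Valuation.ne_zero_iff _).2 hC
  set k : ℤ := WithZero.log (Valued.v C) with hk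
  have hCk : Valued.v C = WithZero.exp k := (WithZero.exp_log hC0).symm
  refine ⟨k.natAbs, fun i hi => ?_⟩
  rw [map_mul, map_inv₀, map_pow, hϖ, hCk, ← WithZero.exp_nsmul, ← WithZero.exp_neg, ← WithZero.exp_add, ← WithZero.exp_zero,
    WithZero.exp_lt_exp, smul_neg, neg_neg, nsmul_eq_mul, mul_one]
  push_cast
  omega

set_option synthInstance.maxHeartbeats 120000 in
/-- **THE FIXED-POINT SET OF A θ-TORUS ELEMENT ON `H ⧸ H^K_m` IS FINITE** — the hypothesis `hfin` of ★ `natCard_fixedPoints_flickerTorus_eq_finsum` (Cor. 9) DISCHARGED: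
through ★ `exists_equiv_sigma_prod_fixedPoints` (`Fix ≃ Σᵢ (T⧸Tᵢ) × Fᵢ`) with (i) `T⧸Tᵢ` finite (★ B-p12's weight `≠ 0`), (ii) `Fᵢ ⊆ P_H ⧸ (P_H ∩ H^K_m)` finite (★ FILE D
`finite_quotient_flickerHK`), (iii) `Fᵢ = ∅` once `|C ϖ^{−2i}| > 1` (`not_mem_flickerHK_of_one_lt` at the conjugate `rᵢ⁻¹ t rᵢ = !![A,0,Bϖ^{2i};0,b₀,0;Cϖ^{−2i},0,A]`).
[cite: Flicker1998UnitaryFL, Cor. 9 p. 85; Prop. 6 p. 83; Prop. 8 p. 84; Prop. 10 p. 85] -/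
theorem finite_fixedPoints_flickerTorus (hJ : J = (StdForm.antidiagonal 3).over K) (hd : LocalConjDatum σ ϖ) {y : K}
    (hy : y * σ y = -2) (hσO : ∀ z : 𝒪[K], (σ.comp 𝒪[K].subtype) z ∈ 𝒪[K]) (m : ℕ) {um : ↥(unitaryGroupOfForm σ J)}
    (hum : ((um : GL (Fin 3) K) : Matrix (Fin 3) (Fin 3) K) = !![ϖ ^ m, y, (ϖ ^ m)⁻¹; 0, 1, -σ y * (ϖ ^ m)⁻¹; 0, 0, (ϖ ^ m)⁻¹])
    [IsDiscreteValuationRing 𝒪[K]] [Finite (ResidueField 𝒪[K])] {q : ℕ} (hq : Nat.card (ResidueField 𝒪[K]) = q ^ 2)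
    {a₀ : 𝒪[K]} (ha₀ : IsUnit (((σ.comp 𝒪[K].subtype).codRestrict 𝒪[K] hσO) a₀ - a₀))
    {R : Type u} [CommRing R] [IsDomain R] [IsDiscreteValuationRing R] [Finite (ResidueField R)] (ι : R →+* K) (hι : Function.Injective ι)
    (hιv : ∀ x : K, Valued.v x ≤ 1 ↔ x ∈ Set.range ι) (σR : R →+* R) (hσR : ∀ r, σR (σR r) = r) (hσι : ∀ r, ι (σR r) = σ (ι r))
    {dR : R} (hdRσ : σR dR = -dR) (hdRu : IsUnit dR) (h2R : IsUnit (2 : R)) {ϖR : R} (hϖR : Irreducible ϖR) (hιϖ : ι ϖR = ϖ)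
    {q₀ : ℕ} (hq₀ : Nat.card (ResidueField R) = q₀ ^ 2)
    {c : ↥(unitaryGroupOfForm σ J)} (hc : ((c : GL (Fin 3) K) : Matrix (Fin 3) (Fin 3) K) = !![1, 0, 0; 0, -1, 0; 0, 0, 1])
    {θ θ' : K} {ε : ℕ} (hε : ε ≤ 1) (hθε : θ = ϖ ^ ε) (hθ : θ * θ' = 1)
    {t : ↥(unitaryGroupOfForm σ J)} (htH : t ∈ Subgroup.centralizer ({c} : Set ↥(unitaryGroupOfForm σ J))) {A B C b₀ : K}
    (hte : ((t : GL (Fin 3) K) : Matrix (Fin 3) (Fin 3) K) = !![A, 0, B; 0, b₀, 0; C, 0, A]) (hC : C ≠ 0) (hBC : B * θ' = C * θ)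
    (r : ℕ → ↥(Subgroup.centralizer ({c} : Set ↥(unitaryGroupOfForm σ J))))
    (hr : ∀ i, (((r i : ↥(unitaryGroupOfForm σ J)) : GL (Fin 3) K) : Matrix (Fin 3) (Fin 3) K) = !![(ϖ ^ i)⁻¹, 0, 0; 0, 1, 0; 0, 0, ϖ ^ i]) :
    {x : ↥(Subgroup.centralizer ({c} : Set ↥(unitaryGroupOfForm σ J))) ⧸
        (flickerHK σ J c um).subgroupOf (Subgroup.centralizer ({c} : Set ↥(unitaryGroupOfForm σ J))) |
      (⟨t, htH⟩ : ↥(Subgroup.centralizer ({c} : Set ↥(unitaryGroupOfForm σ J)))) • x = x}.Finite := by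
  classical
  have hPHc : flickerPH σ J c ≤ (Subgroup.centralizer ({c} : Set ↥(unitaryGroupOfForm σ J))) := (flickerPH_le_flickerKH σ c).trans (flickerKH_le_centralizer σ c)
  have ht'' : ∀ τ ∈ (Subgroup.centralizer ({(⟨t, htH⟩ : ↥(Subgroup.centralizer ({c} : Set ↥(unitaryGroupOfForm σ J))))} : Set ↥(Subgroup.centralizer ({c} : Set ↥(unitaryGroupOfForm σ J))))), τ * (⟨t, htH⟩ : ↥(Subgroup.centralizer ({c} : Set ↥(unitaryGroupOfForm σ J)))) = (⟨t, htH⟩ : ↥(Subgroup.centralizer ({c} : Set ↥(unitaryGroupOfForm σ J)))) * τ := fun τ hτ => Subgroup.mem_centralizer_singleton_iff.1 hτ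
  have hMK : ((flickerHK σ J c um).subgroupOf (Subgroup.centralizer ({c} : Set ↥(unitaryGroupOfForm σ J)))) ≤ ((flickerKH σ J c).subgroupOf (Subgroup.centralizer ({c} : Set ↥(unitaryGroupOfForm σ J)))) := Subgroup.subgroupOf_mono _ (flickerHK_le_flickerKH σ hJ hd hy m hum hc)
  have hPK : ((flickerPH σ J c).subgroupOf (Subgroup.centralizer ({c} : Set ↥(unitaryGroupOfForm σ J)))) ≤ ((flickerKH σ J c).subgroupOf (Subgroup.centralizer ({c} : Set ↥(unitaryGroupOfForm σ J)))) := Subgroup.subgroupOf_mono _ (flickerPH_le_flickerKH σ c)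
  have hA := exists_mem_centralizer_mul_diagRadial_mul_mem_flickerKH σ hJ hd ι hι hιv σR hσR hσι hdRσ hdRu h2R hϖR hιϖ hc hε hθε hθ htH hte hC hBC r hr
  have hB := eq_of_centralizer_mul_diagRadial_mul_flickerKH_eq σ hJ hd hc hθε hθ htH hte hC hBC r hr
  obtain ⟨e⟩ := exists_equiv_sigma_prod_fixedPoints (Subgroup.centralizer ({(⟨t, htH⟩ : ↥(Subgroup.centralizer ({c} : Set ↥(unitaryGroupOfForm σ J))))} : Set ↥(Subgroup.centralizer ({c} : Set ↥(unitaryGroupOfForm σ J))))) ((flickerKH σ J c).subgroupOf (Subgroup.centralizer ({c} : Set ↥(unitaryGroupOfForm σ J)))) ((flickerHK σ J c um).subgroupOf (Subgroup.centralizer ({c} : Set ↥(unitaryGroupOfForm σ J)))) ((flickerPH σ J c).subgroupOf (Subgroup.centralizer ({c} : Set ↥(unitaryGroupOfForm σ J)))) r (⟨t, htH⟩ : ↥(Subgroup.centralizer ({c} : Set ↥(unitaryGroupOfForm σ J)))) ht'' hMK hPK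
    (fun k hk => exists_mem_flickerPH_mul_mem_flickerHK σ hJ hd hy m hum hc k hk) hA hB
  -- (i) each `T ⧸ Tᵢ` is finite: its index is the (non-zero) weight
  have hfinT : ∀ i, Finite (↥(Subgroup.centralizer ({(⟨t, htH⟩ : ↥(Subgroup.centralizer ({c} : Set ↥(unitaryGroupOfForm σ J))))} : Set ↥(Subgroup.centralizer ({c} : Set ↥(unitaryGroupOfForm σ J))))) ⧸ (((flickerKH σ J c).subgroupOf (Subgroup.centralizer ({c} : Set ↥(unitaryGroupOfForm σ J)))).map (MulAut.conj (r i)).toMonoidHom).subgroupOf (Subgroup.centralizer ({(⟨t, htH⟩ : ↥(Subgroup.centralizer ({c} : Set ↥(unitaryGroupOfForm σ J))))} : Set ↥(Subgroup.centralizer ({c} : Set ↥(unitaryGroupOfForm σ J)))))) := by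
    intro i
    haveI : ((((flickerKH σ J c).subgroupOf (Subgroup.centralizer ({c} : Set ↥(unitaryGroupOfForm σ J)))).map (MulAut.conj (r i)).toMonoidHom).subgroupOf (Subgroup.centralizer ({(⟨t, htH⟩ : ↥(Subgroup.centralizer ({c} : Set ↥(unitaryGroupOfForm σ J))))} : Set ↥(Subgroup.centralizer ({c} : Set ↥(unitaryGroupOfForm σ J)))))).FiniteIndex := by
      refine ⟨?_⟩
      change (((flickerKH σ J c).subgroupOf (Subgroup.centralizer ({c} : Set ↥(unitaryGroupOfForm σ J)))).map (MulAut.conj (r i)).toMonoidHom).relIndex (Subgroup.centralizer ({(⟨t, htH⟩ : ↥(Subgroup.centralizer ({c} : Set ↥(unitaryGroupOfForm σ J))))} : Set ↥(Subgroup.centralizer ({c} : Set ↥(unitaryGroupOfForm σ J))))) ≠ 0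
      rw [relIndex_flickerKH_conj_diagRadial_eq σ hJ hd ι hι hιv σR hσR hσι hdRσ hdRu h2R hϖR hιϖ hq₀ hc hθε hθ htH hte hC hBC r hr i]
      have hq2 : 2 ≤ q₀ := by
        have h1 : 1 < Nat.card (ResidueField R) := Finite.one_lt_card_iff_nontrivial.2 inferInstance
        rw [hq₀] at h1
        by_contra hlt
        interval_cases q₀ <;> simp at h1
      split_ifs
      · exact one_ne_zero
      · exact Nat.mul_ne_zero (by omega) (pow_ne_zero _ (by omega))
    infer_instance
  -- (ii) `P_H ⧸ (P_H ∩ H^K_m)` read inside `Hc` is finite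
  haveI hfinQ : Finite (↥((flickerPH σ J c).subgroupOf (Subgroup.centralizer ({c} : Set ↥(unitaryGroupOfForm σ J)))) ⧸ ((flickerHK σ J c um).subgroupOf (Subgroup.centralizer ({c} : Set ↥(unitaryGroupOfForm σ J)))).subgroupOf ((flickerPH σ J c).subgroupOf (Subgroup.centralizer ({c} : Set ↥(unitaryGroupOfForm σ J))))) := by
    haveI := finite_quotient_flickerHK σ hJ hd hy hσO m hum hc hq ha₀
    haveI : ((flickerHK σ J c um).subgroupOf (flickerPH σ J c)).FiniteIndex := Subgroup.finiteIndex_of_finite_quotient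
    haveI : (((flickerHK σ J c um).subgroupOf (Subgroup.centralizer ({c} : Set ↥(unitaryGroupOfForm σ J)))).subgroupOf ((flickerPH σ J c).subgroupOf (Subgroup.centralizer ({c} : Set ↥(unitaryGroupOfForm σ J))))).FiniteIndex := by
      refine ⟨?_⟩
      change ((flickerHK σ J c um).subgroupOf (Subgroup.centralizer ({c} : Set ↥(unitaryGroupOfForm σ J)))).relIndex ((flickerPH σ J c).subgroupOf (Subgroup.centralizer ({c} : Set ↥(unitaryGroupOfForm σ J)))) ≠ 0
      rw [Subgroup.relIndex_subgroupOf hPHc]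
      exact Subgroup.FiniteIndex.index_ne_zero
    infer_instance
  -- (iii) the inner sets are empty for large `i`
  obtain ⟨i₀, hi₀⟩ := exists_forall_one_lt_v_mul_inv_pow hd.vϖ hC
  have hempty : ∀ i, i₀ < i → IsEmpty {w : ↥((flickerPH σ J c).subgroupOf (Subgroup.centralizer ({c} : Set ↥(unitaryGroupOfForm σ J)))) ⧸ ((flickerHK σ J c um).subgroupOf (Subgroup.centralizer ({c} : Set ↥(unitaryGroupOfForm σ J)))).subgroupOf ((flickerPH σ J c).subgroupOf (Subgroup.centralizer ({c} : Set ↥(unitaryGroupOfForm σ J)))) // ((Quotient.out w : ↥((flickerPH σ J c).subgroupOf (Subgroup.centralizer ({c} : Set ↥(unitaryGroupOfForm σ J))))) : ↥(Subgroup.centralizer ({c} : Set ↥(unitaryGroupOfForm σ J))))⁻¹ * ((r i)⁻¹ * (⟨t, htH⟩ : ↥(Subgroup.centralizer ({c} : Set ↥(unitaryGroupOfForm σ J)))) * r i) * (Quotient.out w : ↥((flickerPH σ J c).subgroupOf (Subgroup.centralizer ({c} : Set ↥(unitaryGroupOfForm σ J))))) ∈ ((flickerHK σ J c um).subgroupOf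 (Subgroup.centralizer ({c} : Set ↥(unitaryGroupOfForm σ J))))} := by
    intro i hi
    refine ⟨fun ⟨w, hw⟩ => ?_⟩
    have hpP : (((Quotient.out w : ↥((flickerPH σ J c).subgroupOf (Subgroup.centralizer ({c} : Set ↥(unitaryGroupOfForm σ J))))) : ↥(Subgroup.centralizer ({c} : Set ↥(unitaryGroupOfForm σ J)))) : ↥(unitaryGroupOfForm σ J)) ∈ flickerPH σ J c := (Quotient.out w).2
    have hτH : (((r i)⁻¹ * (⟨t, htH⟩ : ↥(Subgroup.centralizer ({c} : Set ↥(unitaryGroupOfForm σ J)))) * r i : ↥(Subgroup.centralizer ({c} : Set ↥(unitaryGroupOfForm σ J)))) : ↥(unitaryGroupOfForm σ J)) ∈ Subgroup.centralizer ({c} : Set ↥(unitaryGroupOfForm σ J)) := SetLike.coe_mem _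
    have hmem : (((Quotient.out w : ↥((flickerPH σ J c).subgroupOf (Subgroup.centralizer ({c} : Set ↥(unitaryGroupOfForm σ J))))) : ↥(Subgroup.centralizer ({c} : Set ↥(unitaryGroupOfForm σ J)))) : ↥(unitaryGroupOfForm σ J))⁻¹ * (((r i)⁻¹ * (⟨t, htH⟩ : ↥(Subgroup.centralizer ({c} : Set ↥(unitaryGroupOfForm σ J)))) * r i : ↥(Subgroup.centralizer ({c} : Set ↥(unitaryGroupOfForm σ J)))) : ↥(unitaryGroupOfForm σ J)) *
        (((Quotient.out w : ↥((flickerPH σ J c).subgroupOf (Subgroup.centralizer ({c} : Set ↥(unitaryGroupOfForm σ J))))) : ↥(Subgroup.centralizer ({c} : Set ↥(unitaryGroupOfForm σ J)))) : ↥(unitaryGroupOfForm σ J)) ∈ flickerHK σ J c um := by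
      have hw' := Subgroup.mem_subgroupOf.1 hw
      simpa only [Subgroup.coe_mul, InvMemClass.coe_inv] using hw'
    exact not_mem_flickerHK_of_one_lt σ hJ hd hy m hc hum (coe_diagRadial_inv_mul_mul σ hd htH hte r hr i) hτH (hi₀ i hi) hpP hmem
  -- assemble: `Fix ≃ Σᵢ …`, and the sigma type is finite (empty fibres beyond `i₀`)
  rw [← Set.finite_coe_iff]
  haveI : ∀ i, Finite ((↥(Subgroup.centralizer ({(⟨t, htH⟩ : ↥(Subgroup.centralizer ({c} : Set ↥(unitaryGroupOfForm σ J))))} : Set ↥(Subgroup.centralizer ({c} : Set ↥(unitaryGroupOfForm σ J))))) ⧸ (((flickerKH σ J c).subgroupOf (Subgroup.centralizer ({c} : Set ↥(unitaryGroupOfForm σ J)))).map (MulAut.conj (r i)).toMonoidHom).subgroupOf (Subgroup.centralizer ({(⟨t, htH⟩ : ↥(Subgroup.centralizer ({c} : Set ↥(unitaryGroupOfForm σ J))))} : Set ↥(Subgroup.centralizer ({c} : Set ↥(unitaryGroupOfForm σ J)))))) × {w : ↥((flickerPH σ J c).subgroupOf (Subgroup.centralizer ({c} : Set ↥(unitaryGroupOfForm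 σ J)))) ⧸ ((flickerHK σ J c um).subgroupOf (Subgroup.centralizer ({c} : Set ↥(unitaryGroupOfForm σ J)))).subgroupOf ((flickerPH σ J c).subgroupOf (Subgroup.centralizer ({c} : Set ↥(unitaryGroupOfForm σ J)))) // ((Quotient.out w : ↥((flickerPH σ J c).subgroupOf (Subgroup.centralizer ({c} : Set ↥(unitaryGroupOfForm σ J))))) : ↥(Subgroup.centralizer ({c} : Set ↥(unitaryGroupOfForm σ J))))⁻¹ * ((r i)⁻¹ * (⟨t, htH⟩ : ↥(Subgroup.centralizer ({c} : Set ↥(unitaryGroupOfForm σ J)))) * r i) * (Quotient.out w : ↥((flickerPH σ J c).subgroupOf (Subgroup.centralizer ({c} : Set ↥(unitaryGroupOfForm σ J))))) ∈ ((flickerHK σ J c um).subgroupOf (Subgroup.centralizer ({c} : Set ↥(unitaryGroupOfForm σ J))))}) := by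
    intro i; haveI := hfinT i; infer_instance
  haveI : Finite (Σ i : ℕ, (↥(Subgroup.centralizer ({(⟨t, htH⟩ : ↥(Subgroup.centralizer ({c} : Set ↥(unitaryGroupOfForm σ J))))} : Set ↥(Subgroup.centralizer ({c} : Set ↥(unitaryGroupOfForm σ J))))) ⧸ (((flickerKH σ J c).subgroupOf (Subgroup.centralizer ({c} : Set ↥(unitaryGroupOfForm σ J)))).map (MulAut.conj (r i)).toMonoidHom).subgroupOf (Subgroup.centralizer ({(⟨t, htH⟩ : ↥(Subgroup.centralizer ({c} : Set ↥(unitaryGroupOfForm σ J))))} : Set ↥(Subgroup.centralizer ({c} : Set ↥(unitaryGroupOfForm σ J)))))) × {w : ↥((flickerPH σ J c).subgroupOf (Subgroup.centralizer ({c} : Set ↥(unitaryGroupOfForm σ J)))) ⧸ ((flickerHK σ J c um).subgroupOf (Subgroup.centralizer ({c} : Set ↥(unitaryGroupOfForm σ J)))).subgroupOf ((flickerPH σ J c).subgroupOf (Subgroup.centralizer ({c} : Set ↥(unitaryGroupOfForm σ J)))) // ((Quotient.out w : ↥((flickerPH σ J c).subgroupOf (Subgroup.centralizer ({c} : Set ↥(unitaryGroupOfForm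 σ J))))) : ↥(Subgroup.centralizer ({c} : Set ↥(unitaryGroupOfForm σ J))))⁻¹ * ((r i)⁻¹ * (⟨t, htH⟩ : ↥(Subgroup.centralizer ({c} : Set ↥(unitaryGroupOfForm σ J)))) * r i) * (Quotient.out w : ↥((flickerPH σ J c).subgroupOf (Subgroup.centralizer ({c} : Set ↥(unitaryGroupOfForm σ J))))) ∈ ((flickerHK σ J c um).subgroupOf (Subgroup.centralizer ({c} : Set ↥(unitaryGroupOfForm σ J))))}) := by
    refine Finite.of_surjective (fun s : Σ j : Fin (i₀ + 1), (↥(Subgroup.centralizer ({(⟨t, htH⟩ : ↥(Subgroup.centralizer ({c} : Set ↥(unitaryGroupOfForm σ J))))} : Set ↥(Subgroup.centralizer ({c} : Set ↥(unitaryGroupOfForm σ J))))) ⧸ (((flickerKH σ J c).subgroupOf (Subgroup.centralizer ({c} : Set ↥(unitaryGroupOfForm σ J)))).map (MulAut.conj (r (j : ℕ))).toMonoidHom).subgroupOf (Subgroup.centralizer ({(⟨t, htH⟩ : ↥(Subgroup.centralizer ({c} : Set ↥(unitaryGroupOfForm σ J))))} : Set ↥(Subgroup.centralizer ({c} : Set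 ↥(unitaryGroupOfForm σ J)))))) × {w : ↥((flickerPH σ J c).subgroupOf (Subgroup.centralizer ({c} : Set ↥(unitaryGroupOfForm σ J)))) ⧸ ((flickerHK σ J c um).subgroupOf (Subgroup.centralizer ({c} : Set ↥(unitaryGroupOfForm σ J)))).subgroupOf ((flickerPH σ J c).subgroupOf (Subgroup.centralizer ({c} : Set ↥(unitaryGroupOfForm σ J)))) // ((Quotient.out w : ↥((flickerPH σ J c).subgroupOf (Subgroup.centralizer ({c} : Set ↥(unitaryGroupOfForm σ J))))) : ↥(Subgroup.centralizer ({c} : Set ↥(unitaryGroupOfForm σ J))))⁻¹ * ((r (j : ℕ))⁻¹ * (⟨t, htH⟩ : ↥(Subgroup.centralizer ({c} : Set ↥(unitaryGroupOfForm σ J)))) * r (j : ℕ)) * (Quotient.out w : ↥((flickerPH σ J c).subgroupOf (Subgroup.centralizer ({c} : Set ↥(unitaryGroupOfForm σ J))))) ∈ ((flickerHK σ J c um).subgroupOf (Subgroup.centralizer ({c} : Set ↥(unitaryGroupOfForm σ J))))} => (⟨(s.1 : ℕ), s.2⟩ : Σ i : ℕ, (↥(Subgroup.centralizer ({(⟨t,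 htH⟩ : ↥(Subgroup.centralizer ({c} : Set ↥(unitaryGroupOfForm σ J))))} : Set ↥(Subgroup.centralizer ({c} : Set ↥(unitaryGroupOfForm σ J))))) ⧸ (((flickerKH σ J c).subgroupOf (Subgroup.centralizer ({c} : Set ↥(unitaryGroupOfForm σ J)))).map (MulAut.conj (r i)).toMonoidHom).subgroupOf (Subgroup.centralizer ({(⟨t, htH⟩ : ↥(Subgroup.centralizer ({c} : Set ↥(unitaryGroupOfForm σ J))))} : Set ↥(Subgroup.centralizer ({c} : Set ↥(unitaryGroupOfForm σ J)))))) × {w : ↥((flickerPH σ J c).subgroupOf (Subgroup.centralizer ({c} : Set ↥(unitaryGroupOfForm σ J)))) ⧸ ((flickerHK σ J c um).subgroupOf (Subgroup.centralizer ({c} : Set ↥(unitaryGroupOfForm σ J)))).subgroupOf ((flickerPH σ J c).subgroupOf (Subgroup.centralizer ({c} : Set ↥(unitaryGroupOfForm σ J)))) // ((Quotient.out w : ↥((flickerPH σ J c).subgroupOf (Subgroup.centralizer ({c} : Set ↥(unitaryGroupOfForm σ J))))) : ↥(Subgroup.centralizer ({c} : Set ↥(unitaryGroupOfForm σ J))))⁻¹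 * ((r i)⁻¹ * (⟨t, htH⟩ : ↥(Subgroup.centralizer ({c} : Set ↥(unitaryGroupOfForm σ J)))) * r i) * (Quotient.out w : ↥((flickerPH σ J c).subgroupOf (Subgroup.centralizer ({c} : Set ↥(unitaryGroupOfForm σ J))))) ∈ ((flickerHK σ J c um).subgroupOf (Subgroup.centralizer ({c} : Set ↥(unitaryGroupOfForm σ J))))})) ?_
    rintro ⟨i, x⟩
    have hi : i ≤ i₀ := le_of_not_gt fun h => (hempty i h).false x.2
    exact ⟨⟨⟨i, Nat.lt_succ_of_le hi⟩, x⟩, rfl⟩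
  exact Finite.of_equiv _ e

set_option synthInstance.maxHeartbeats 120000 in
/-- **FLICKER'S COR. 9 AT THE θ-TORUS WITH NO STRUCTURAL HYPOTHESIS LEFT**: ★ `natCard_fixedPoints_flickerTorus_eq_finsum` (p841650) with `hfin` discharged by
`finite_fixedPoints_flickerTorus`. [cite: Flicker1998UnitaryFL, Cor. 9 p. 85; Prop. 6 p. 83; Prop. 8 p. 84] -/
theorem natCard_fixedPoints_flickerTorus_eq_finsum' (hJ : J = (StdForm.antidiagonal 3).over K) (hd : LocalConjDatum σ ϖ) {y : K}
    (hy : y * σ y = -2) (hσO : ∀ z : 𝒪[K], (σ.comp 𝒪[K].subtype) z ∈ 𝒪[K]) (m : ℕ) {um : ↥(unitaryGroupOfForm σ J)}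
    (hum : ((um : GL (Fin 3) K) : Matrix (Fin 3) (Fin 3) K) = !![ϖ ^ m, y, (ϖ ^ m)⁻¹; 0, 1, -σ y * (ϖ ^ m)⁻¹; 0, 0, (ϖ ^ m)⁻¹])
    [IsDiscreteValuationRing 𝒪[K]] [Finite (ResidueField 𝒪[K])] {q : ℕ} (hq : Nat.card (ResidueField 𝒪[K]) = q ^ 2)
    {a₀ : 𝒪[K]} (ha₀ : IsUnit (((σ.comp 𝒪[K].subtype).codRestrict 𝒪[K] hσO) a₀ - a₀))
    {R : Type u} [CommRing R] [IsDomain R] [IsDiscreteValuationRing R] [Finite (ResidueField R)] (ι : R →+* K) (hι : Function.Injective ι)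
    (hιv : ∀ x : K, Valued.v x ≤ 1 ↔ x ∈ Set.range ι) (σR : R →+* R) (hσR : ∀ r, σR (σR r) = r) (hσι : ∀ r, ι (σR r) = σ (ι r))
    {dR : R} (hdRσ : σR dR = -dR) (hdRu : IsUnit dR) (h2R : IsUnit (2 : R)) {ϖR : R} (hϖR : Irreducible ϖR) (hιϖ : ι ϖR = ϖ)
    {q₀ : ℕ} (hq₀ : Nat.card (ResidueField R) = q₀ ^ 2)
    {c : ↥(unitaryGroupOfForm σ J)} (hc : ((c : GL (Fin 3) K) : Matrix (Fin 3) (Fin 3) K) = !![1, 0, 0; 0, -1, 0; 0, 0, 1])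
    {θ θ' : K} {ε : ℕ} (hε : ε ≤ 1) (hθε : θ = ϖ ^ ε) (hθ : θ * θ' = 1)
    {t : ↥(unitaryGroupOfForm σ J)} (htH : t ∈ Subgroup.centralizer ({c} : Set ↥(unitaryGroupOfForm σ J))) {A B C b₀ : K}
    (hte : ((t : GL (Fin 3) K) : Matrix (Fin 3) (Fin 3) K) = !![A, 0, B; 0, b₀, 0; C, 0, A]) (hC : C ≠ 0) (hBC : B * θ' = C * θ)
    (r : ℕ → ↥(Subgroup.centralizer ({c} : Set ↥(unitaryGroupOfForm σ J))))
    (hr : ∀ i, (((r i : ↥(unitaryGroupOfForm σ J)) : GL (Fin 3) K) : Matrix (Fin 3) (Fin 3) K) = !![(ϖ ^ i)⁻¹, 0, 0; 0, 1, 0; 0, 0, ϖ ^ i]) :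
    Nat.card {x : ↥(Subgroup.centralizer ({c} : Set ↥(unitaryGroupOfForm σ J))) ⧸ (flickerHK σ J c um).subgroupOf (Subgroup.centralizer ({c} : Set ↥(unitaryGroupOfForm σ J))) // (⟨t, htH⟩ : ↥(Subgroup.centralizer ({c} : Set ↥(unitaryGroupOfForm σ J)))) • x = x} =
      ∑ᶠ i : ℕ, (if 2 * i + ε = 0 then 1 else (q₀ + 1) * q₀ ^ (2 * i + ε - 1)) *
        Nat.card {w : ↥(flickerPH σ J c) ⧸ (flickerHK σ J c um).subgroupOf (flickerPH σ J c) //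
          ((Quotient.out w : ↥(flickerPH σ J c)) : ↥(unitaryGroupOfForm σ J))⁻¹ *
              (((r i)⁻¹ * ⟨t, htH⟩ * r i : ↥(Subgroup.centralizer ({c} : Set ↥(unitaryGroupOfForm σ J)))) : ↥(unitaryGroupOfForm σ J)) *
            (Quotient.out w : ↥(flickerPH σ J c)) ∈ flickerHK σ J c um} :=
  natCard_fixedPoints_flickerTorus_eq_finsum σ hJ hd hy m hum ι hι hιv σR hσR hσι hdRσ hdRu h2R hϖR hιϖ hq₀ hc hε hθε hθ htH hte hC hBC r hr
    (finite_fixedPoints_flickerTorus σ hJ hd hy hσO m hum hq ha₀ ι hι hιv σR hσR hσι hdRσ hdRu h2R hϖR hιϖ hq₀ hc hε hθε hθ htH hte hC hBC r hr)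

end Finite

end UnitaryGroup

end Literature.NumberTheory.Automorphic
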